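import Mathlib
import Literature.Analysis.ODE.PolyharmonicHalfLineLevel
import Literature.Analysis.ODE.LinearSecondOrder
import HarnessLib

/-!
# A Liouville theorem for `(∂² − V)`-polyharmonic chains square-integrable at a regular left end

Topic `Literature/Analysis/ODE` (namespace `Literature.Analysis.ODE`), continuing
`PolyharmonicHalfLineLevel.lean`.  Let `V` be continuous with an exponentially small tail
`|V(x)| ≤ C_V e^{γ x}` on `(−∞, x_e]` (`γ > 0`).  A **polyharmonic chain** on the open half-line
`(−∞, x_e)` is a finite sequence `f_0, …, f_{n−1}` with `f_j'' = V f_j + f_{j+1}` there and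
`f_n = 0`; equivalently `(∂² − V)^n f_0 = 0` with `f_j = (∂² − V)^j f_0`.  For `V = 0` these are the
polynomials of degree `< 2n`; in general (Hartman, Ch. X §1, §17: asymptotic integration of
perturbations of `y⁽²ⁿ⁾ = 0` with integrable coefficients) every `f_j` is a polynomial plus an
exponentially small remainder towards `−∞` (`exists_chain_decomposition`, from `level_step`).

Main result `polyharmonic_chain_eq_zero_of_integrableOn_sq`: **if `f_0` is square-integrable on
`(−∞, x_e)` then the whole chain vanishes identically.**  (The polynomial part of `f_0` must vanish;
then, level by level upwards, all polynomial parts vanish exactly; then, level by level downwards,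
each `f_j` solves a homogeneous Volterra equation `f_j = ∫∫ V f_j` with an exponentially small
kernel and is therefore zero near `−∞`, hence everywhere by uniqueness for the linear equation
`u'' = V u`, `eqOn_of_solution_Ioo`.)

This is the census of the finite-energy part of the `t`-polynomial kernel of the channel-of-energy
inequality on the horizon side of the Schwarzschild photon sphere (route `PhotonSphereChannels` of
the Final State Conjecture, item `UniformPhotonSphereChannels`): a `t`-polynomial solution
`Σ a_i(x) tⁱ` of `ψ_tt − ψ_xx + Vψ = 0` has velocity coefficient `a_1` at the bottom of such a
chain, so `a_1 ∈ L²` towards the horizon forces `a_1 = 0`.  Everything is proved; no definitions.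

## References

* P. Hartman, *Ordinary Differential Equations*, SIAM Classics 38 (2002), Ch. X §1, §17
  (key `Hartman2002`).
-/

namespace Literature.Analysis.ODE

open _root_.MeasureTheory _root_.Set _root_.Filter _root_.Topology intervalIntegral Polynomial

noncomputable section

/-! ### Two vanishing lemmas -/

/-- A polynomial that is within `O(e^{λx})` (`λ > 0`) of a function square-integrable on a left
half-line is zero. [folklore] -/
theorem polynomial_eq_zero_of_integrableOn_sq {u : ℝ → ℝ} {P : ℝ[X]} {X C lam : ℝ} (hlam : 0 < lam)
    (hP : ∀ x ≤ X, |u x - P.eval x| ≤ C * Real.exp (lam * x))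
    (hu : IntegrableOn (fun x => u x ^ 2) (Iic X)) : P = 0 := by
  by_contra hne
  obtain ⟨δ, hδ, X₁, hX₁⟩ := exists_pos_le_abs_eval_of_ne_zero hne
  -- the error is eventually `≤ δ/2`
  have hC : 0 ≤ C := nonneg_of_abs_le_mul_exp (hP X le_rfl)
  have hlim : Tendsto (fun x => C * Real.exp (lam * x)) atBot (𝓝 0) := by
    have := (Real.tendsto_exp_atBot.comp (tendsto_id.const_mul_atBot hlam)).const_mul C
    simpa using this
  obtain ⟨X₂, hX₂⟩ := eventually_atBot.1 (hlim.eventually (ge_mem_nhds (half_pos hδ)))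
  set X₃ : ℝ := min X (min X₁ X₂) with hX₃
  have hlow : ∀ x ≤ X₃, δ / 2 ≤ |u x| := by
    intro x hx
    have hxX : x ≤ X := hx.trans (min_le_left _ _)
    have hx1 : x ≤ X₁ := hx.trans ((min_le_right _ _).trans (min_le_left _ _))
    have hx2 : x ≤ X₂ := hx.trans ((min_le_right _ _).trans (min_le_right _ _))
    have h1 := hX₁ x hx1
    have h2 : |u x - P.eval x| ≤ δ / 2 := (hP x hxX).trans (hX₂ x hx2)
    have h3 : |P.eval x| ≤ |u x| + |u x - P.eval x| := by
      have := abs_sub_abs_le_abs_sub (P.eval x) (u x)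
      rw [abs_sub_comm] at this
      linarith
    linarith
  -- the constant `(δ/2)²` would be integrable on `Iic X₃`, which has infinite measure
  have hint : IntegrableOn (fun _ : ℝ => (δ / 2) ^ 2) (Iic X₃) := by
    refine Integrable.mono' (hu.mono_set (Iic_subset_Iic.2 (min_le_left _ _)))
      aestronglyMeasurable_const ?_
    refine (ae_restrict_iff' measurableSet_Iic).2 (Eventually.of_forall fun x hx => ?_)
    rw [Real.norm_eq_abs, abs_of_nonneg (sq_nonneg _), ← sq_abs (u x)]
    exact pow_le_pow_left₀ (by positivity) (hlow x hx) 2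
  rw [integrableOn_const_iff] at hint
  rcases hint with h | h
  · have hδ2 : (δ / 2) ^ 2 ≠ 0 := by positivity
    exact hδ2 (by simpa using h)
  · simp at h

/-- **Homogeneous Volterra equations with exponentially small kernel have only the zero solution
near `−∞`.** If `u` (continuous, `|u| ≤ C e^{γx/2}` on `(−∞, X]`) satisfies
`u(x) = ∫_{(−∞,x]}∫_{(−∞,s]} V u` for `x < X'` (`X < X'`), `|V| ≤ C_V e^{γ x}` on `(−∞, X]`, and
`C_V e^{γ X₃} ≤ γ²/2`, `X₃ ≤ X`, then `u = 0` on `(−∞, X₃]` (iterate the estimate: each pass gains a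
factor `C_V e^{γ x}/γ² ≤ 1/2`). [folklore] -/
theorem eq_zero_of_volterra_leftTail2 {V u : ℝ → ℝ} (hV : Continuous V) {C_V γ X X' X₃ C : ℝ}
    (hγ : 0 < γ) (hVb : ∀ x ≤ X, |V x| ≤ C_V * Real.exp (γ * x)) (hXX' : X < X')
    (huc : Continuous u) (hub : ∀ x ≤ X, |u x| ≤ C * Real.exp (γ / 2 * x))
    (hrep : ∀ x < X', u x = ∫ s in Iic x, ∫ σ in Iic s, V σ * u σ)
    (hX₃ : C_V * Real.exp (γ * X₃) ≤ γ ^ 2 / 2) (hX₃X : X₃ ≤ X) :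
    ∀ x ≤ X₃, u x = 0 := by
  have hC_V : 0 ≤ C_V := nonneg_of_abs_le_mul_exp (hVb X le_rfl)
  have hC : 0 ≤ C := nonneg_of_abs_le_mul_exp (hub X le_rfl)
  -- iterated bounds on all of `(−∞, X]`
  have hiter : ∀ k : ℕ, ∀ x ≤ X,
      |u x| ≤ C * (C_V / γ ^ 2) ^ k * Real.exp ((γ / 2 + k * γ) * x) := by
    intro k
    induction k with
    | zero => intro x hx; simpa using hub x hx
    | succ k ih =>
        intro x hx
        have hrate : 0 < γ / 2 + k * γ + γ := by positivity
        have hkb : ∀ s ≤ X, |(fun s => V s * u s) s|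
            ≤ C_V * (C * (C_V / γ ^ 2) ^ k) * Real.exp ((γ + (γ / 2 + k * γ)) * s) :=
          fun s hs => abs_mul_le_mul_exp_add (hVb s hs) (ih s hs)
        have hrate' : 0 < γ + (γ / 2 + k * γ) := by positivity
        have h2 := abs_leftTail2_le hrate' (show Continuous (fun s => V s * u s) from hV.mul huc)
          hkb hx
        rw [← hrep x (lt_of_le_of_lt hx hXX')] at h2
        refine h2.trans ?_
        have hden : γ ^ 2 ≤ (γ + (γ / 2 + k * γ)) ^ 2 := by
          apply pow_le_pow_left₀ hγ.le
          have : (0 : ℝ) ≤ γ / 2 + k * γ := by positivity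
          linarith
        have hnum : 0 ≤ C_V * (C * (C_V / γ ^ 2) ^ k) := by positivity
        calc C_V * (C * (C_V / γ ^ 2) ^ k) / (γ + (γ / 2 + ↑k * γ)) ^ 2
              * Real.exp ((γ + (γ / 2 + ↑k * γ)) * x)
            ≤ C_V * (C * (C_V / γ ^ 2) ^ k) / γ ^ 2 * Real.exp ((γ + (γ / 2 + ↑k * γ)) * x) := by
              gcongr
          _ = C * (C_V / γ ^ 2) ^ (k + 1) * Real.exp ((γ / 2 + ↑(k + 1) * γ) * x) := by
              have hexp : (γ + (γ / 2 + ↑k * γ)) * x = (γ / 2 + ↑(k + 1) * γ) * x := by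
                push_cast; ring
              rw [hexp, pow_succ (C_V / γ ^ 2) k]
              field_simp
  -- on `(−∞, X₃]` the geometric factor is `≤ 1/2`
  intro x hx
  have hq : C_V * Real.exp (γ * x) / γ ^ 2 ≤ 1 / 2 := by
    rw [div_le_iff₀ (by positivity)]
    have : Real.exp (γ * x) ≤ Real.exp (γ * X₃) := Real.exp_le_exp.2 (by nlinarith)
    nlinarith [mul_le_mul_of_nonneg_left this hC_V]
  have hq0 : 0 ≤ C_V * Real.exp (γ * x) / γ ^ 2 := by positivity
  have hbound : ∀ k : ℕ, |u x| ≤ C * Real.exp (γ / 2 * x) * (1 / 2) ^ k := by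
    intro k
    have h := hiter k x (hx.trans hX₃X)
    have heq : C * (C_V / γ ^ 2) ^ k * Real.exp ((γ / 2 + k * γ) * x)
        = C * Real.exp (γ / 2 * x) * (C_V * Real.exp (γ * x) / γ ^ 2) ^ k := by
      rw [show (γ / 2 + ↑k * γ) * x = γ / 2 * x + ↑k * (γ * x) by ring, Real.exp_add,
        Real.exp_nat_mul, div_pow, div_pow, mul_pow]
      ring
    rw [heq] at h
    refine h.trans ?_
    exact mul_le_mul_of_nonneg_left (pow_le_pow_left₀ hq0 hq k) (by positivity)
  have hlim : Tendsto (fun k : ℕ => C * Real.exp (γ / 2 * x) * (1 / 2 : ℝ) ^ k) atTop (𝓝 0) := by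
    have := (tendsto_pow_atTop_nhds_zero_of_lt_one (by norm_num : (0 : ℝ) ≤ 1 / 2)
      (by norm_num)).const_mul (C * Real.exp (γ / 2 * x))
    simpa using this
  have habs : |u x| ≤ 0 := ge_of_tendsto' hlim hbound
  exact abs_nonpos_iff.1 habs

/-! ### Decomposition of a polyharmonic chain into polynomials plus exponentially small tails -/

/-- **Asymptotic integration of a polyharmonic chain.** Let `V` be continuous with
`|V| ≤ C_V e^{γx}` on `(−∞, X]`, `γ > 0`, and let `F_0, …, F_n` be continuous on `ℝ` with
`F_j' = G_j`, `G_j' = V F_j + F_{j+1}` on `(−∞, X')` (`X < X'`) for `j < n` and `F_n = 0`.  Then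
there are polynomials `P_j` (`P_n = 0`) and a constant `C` such that for every `j < n`, with
`k_j = V F_j + (F_{j+1} − P_{j+1})`: `|F_j − P_j| ≤ C e^{γx/2}` and `|k_j| ≤ C e^{γx/2}` on
`(−∞, X]`, and `F_j = P_j + ∫_{(−∞,x]}∫_{(−∞,s]} k_j` on `(−∞, X')`. [folklore] -/
theorem exists_chain_decomposition {V : ℝ → ℝ} (hV : Continuous V) {C_V γ X X' : ℝ} (hγ : 0 < γ)
    (hVb : ∀ x ≤ X, |V x| ≤ C_V * Real.exp (γ * x)) (hXX' : X < X') {n : ℕ} {F G : ℕ → ℝ → ℝ}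
    (hFc : ∀ j ≤ n, Continuous (F j))
    (hF : ∀ j < n, ∀ x < X', HasDerivAt (F j) (G j x) x)
    (hG : ∀ j < n, ∀ x < X', HasDerivAt (G j) (V x * F j x + F (j + 1) x) x)
    (htop : ∀ x, F n x = 0) :
    ∃ (P : ℕ → ℝ[X]) (C : ℝ), P n = 0 ∧ ∀ j < n,
      (∀ x ≤ X, |F j x - (P j).eval x| ≤ C * Real.exp (γ / 2 * x)) ∧
      (∀ x ≤ X, |V x * F j x + (F (j + 1) x - (P (j + 1)).eval x)| ≤ C * Real.exp (γ / 2 * x)) ∧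
      (∀ x < X', F j x = (P j).eval x
        + ∫ s in Iic x, ∫ σ in Iic s, (V σ * F j σ + (F (j + 1) σ - (P (j + 1)).eval σ))) := by
  -- downward induction on the number `m` of treated levels `j ≥ n - m`
  suffices H : ∀ m ≤ n, ∃ (P : ℕ → ℝ[X]) (C : ℝ), P n = 0 ∧ ∀ j < n, n - m ≤ j →
      (∀ x ≤ X, |F j x - (P j).eval x| ≤ C * Real.exp (γ / 2 * x)) ∧
      (∀ x ≤ X, |V x * F j x + (F (j + 1) x - (P (j + 1)).eval x)| ≤ C * Real.exp (γ / 2 * x)) ∧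
      (∀ x < X', F j x = (P j).eval x
        + ∫ s in Iic x, ∫ σ in Iic s, (V σ * F j σ + (F (j + 1) σ - (P (j + 1)).eval σ))) by
    obtain ⟨P, C, hPn, h⟩ := H n le_rfl
    exact ⟨P, C, hPn, fun j hj => h j hj (by omega)⟩
  intro m
  induction m with
  | zero =>
      intro _
      exact ⟨fun _ => 0, 0, rfl, fun j hj hnj => by omega⟩
  | succ m ih =>
      intro hm
      obtain ⟨P, C, hPn, h⟩ := ih (by omega)
      -- the new level
      set j₀ : ℕ := n - (m + 1) with hj₀
      have hj₀n : j₀ < n := by omega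
      -- forcing bound at level `j₀ + 1`
      have hC0 : 0 ≤ C ∨ True := Or.inr trivial
      have hforce : ∀ x ≤ X, |F (j₀ + 1) x - (P (j₀ + 1)).eval x|
          ≤ max C 0 * Real.exp (γ / 2 * x) := by
        intro x hx
        by_cases hlast : j₀ + 1 = n
        · rw [hlast, htop x, hPn]
          simp
          positivity
        · have h1 := (h (j₀ + 1) (by omega) (by omega)).1 x hx
          exact h1.trans (mul_le_mul_of_nonneg_right (le_max_left _ _) (Real.exp_pos _).le)
      obtain ⟨P₀, C₀, hk₀, hP₀, hrep₀⟩ := level_step hV hγ hVb hXX' (hFc j₀ hj₀n.le)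
        (hFc (j₀ + 1) (by omega)) (hF j₀ hj₀n) (hG j₀ hj₀n) (P (j₀ + 1)) hforce
      refine ⟨fun j => if j = j₀ then P₀ else P j, max C C₀, ?_, fun j hj hnj => ?_⟩
      · simp only
        rw [if_neg (by omega)]
        exact hPn
      · have hC1 : C ≤ max C C₀ := le_max_left _ _
        have hC2 : C₀ ≤ max C C₀ := le_max_right _ _
        by_cases hjj : j = j₀
        · subst hjj
          simp only [if_true, if_neg (show j₀ + 1 ≠ j₀ by omega)]
          refine ⟨fun x hx => (hP₀ x hx).trans ?_, fun x hx => (hk₀ x hx).trans ?_, hrep₀⟩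
          · exact mul_le_mul_of_nonneg_right hC2 (Real.exp_pos _).le
          · exact mul_le_mul_of_nonneg_right hC2 (Real.exp_pos _).le
        · have hold := h j hj (by omega)
          simp only [if_neg hjj, if_neg (show j + 1 ≠ j₀ by omega)]
          refine ⟨fun x hx => (hold.1 x hx).trans ?_, fun x hx => (hold.2.1 x hx).trans ?_,
            hold.2.2⟩
          · exact mul_le_mul_of_nonneg_right hC1 (Real.exp_pos _).le
          · exact mul_le_mul_of_nonneg_right hC1 (Real.exp_pos _).le

/-! ### The Liouville theorem -/

/-- **Liouville theorem for square-integrable polyharmonic chains at an exponentially regular left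
end.** Let `V` be continuous with `|V(x)| ≤ C_V e^{γ x}` for `x ≤ x_e` (`γ > 0`).  Let
`f_0, …, f_n` satisfy `f_j' = g_j`, `g_j' = V f_j + f_{j+1}` on the open half-line `(−∞, x_e)` for
`j < n`, with `f_n = 0` there.  If `f_0` is square-integrable on `(−∞, x_e)`, then `f_j = 0` on
`(−∞, x_e)` for every `j ≤ n`. [folklore] -/
theorem polyharmonic_chain_eq_zero_of_integrableOn_sq {V : ℝ → ℝ} (hV : Continuous V)
    {C_V γ xe : ℝ} (hγ : 0 < γ) (hVb : ∀ x ≤ xe, |V x| ≤ C_V * Real.exp (γ * x))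
    {n : ℕ} {f g : ℕ → ℝ → ℝ}
    (hf : ∀ j < n, ∀ x < xe, HasDerivAt (f j) (g j x) x)
    (hg : ∀ j < n, ∀ x < xe, HasDerivAt (g j) (V x * f j x + f (j + 1) x) x)
    (htop : ∀ x < xe, f n x = 0)
    (hL2 : IntegrableOn (fun x => f 0 x ^ 2) (Iio xe)) :
    ∀ j ≤ n, ∀ x < xe, f j x = 0 := by
  have hC_V : 0 ≤ C_V := nonneg_of_abs_le_mul_exp (hVb xe le_rfl)
  -- geometry of the half-lines: `X₃ ≤ X < X' < xe`
  set X' : ℝ := xe - 1 with hX'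
  set X : ℝ := xe - 2 with hX
  have hXX' : X < X' := by simp only [hX, hX']; linarith
  have hX'e : X' < xe := by simp only [hX']; linarith
  have hVbX : ∀ x ≤ X, |V x| ≤ C_V * Real.exp (γ * x) := fun x hx => hVb x (by linarith)
  -- a point deep enough for the Volterra argument
  obtain ⟨X₃, hX₃X, hX₃⟩ : ∃ X₃, X₃ ≤ X ∧ C_V * Real.exp (γ * X₃) ≤ γ ^ 2 / 2 := by
    have hlim : Tendsto (fun x => C_V * Real.exp (γ * x)) atBot (𝓝 0) := by
      have := (Real.tendsto_exp_atBot.comp (tendsto_id.const_mul_atBot hγ)).const_mul C_V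
      simpa using this
    have hev := hlim.eventually (ge_mem_nhds (show (0 : ℝ) < γ ^ 2 / 2 by positivity))
    obtain ⟨X₄, hX₄⟩ := eventually_atBot.1 hev
    exact ⟨min X X₄, min_le_left _ _, hX₄ _ (min_le_right _ _)⟩
  -- clamped copies, continuous on `ℝ`
  set F : ℕ → ℝ → ℝ := fun j x => f j (min x X') with hFdef
  have hmin : ∀ x, min x X' < xe := fun x => lt_of_le_of_lt (min_le_right _ _) hX'e
  have hFc : ∀ j ≤ n, Continuous (F j) := by
    intro j hj
    rcases hj.lt_or_eq with hj | hj
    · have hcont : ContinuousOn (f j) (Iio xe) := fun x hx =>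
        (hf j hj x hx).continuousAt.continuousWithinAt
      exact hcont.comp_continuous (continuous_id.min continuous_const) fun x => hmin x
    · have : F j = fun _ => 0 := funext fun x => by rw [hj]; exact htop _ (hmin x)
      rw [this]
      exact continuous_const
  have hFeq : ∀ j, ∀ x ≤ X', F j x = f j x := fun j x hx => by
    simp only [hFdef, min_eq_left hx]
  have hFev : ∀ j, ∀ x < X', F j =ᶠ[𝓝 x] f j := fun j x hx => by
    filter_upwards [Iio_mem_nhds hx] with y hy using hFeq j y hy.le
  have hFd : ∀ j < n, ∀ x < X', HasDerivAt (F j) (g j x) x := fun j hj x hx =>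
    (hf j hj x (hx.trans hX'e)).congr_of_eventuallyEq (hFev j x hx)
  have hGd : ∀ j < n, ∀ x < X', HasDerivAt (g j) (V x * F j x + F (j + 1) x) x := by
    intro j hj x hx
    rw [hFeq j x hx.le, hFeq (j + 1) x hx.le]
    exact hg j hj x (hx.trans hX'e)
  have hFtop : ∀ x, F n x = 0 := fun x => htop _ (hmin x)
  -- Step 1: decomposition
  obtain ⟨P, C, hPn, hdec⟩ := exists_chain_decomposition hV hγ hVbX hXX' hFc hFd hGd hFtop
  -- Step 2: the bottom polynomial vanishes
  have hP0 : n = 0 ∨ P 0 = 0 := by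
    rcases Nat.eq_zero_or_pos n with h0 | hpos
    · exact Or.inl h0
    · right
      refine polynomial_eq_zero_of_integrableOn_sq (half_pos hγ) (hdec 0 hpos).1 ?_
      have hsub : Iic X ⊆ Iio xe := fun x hx => lt_of_le_of_lt hx (hXX'.trans hX'e)
      refine (hL2.mono_set hsub).congr_fun (fun x hx => ?_) measurableSet_Iic
      simp only [hFeq 0 x ((mem_Iic.1 hx).trans hXX'.le)]
  -- Step 3: all polynomials vanish (upwards)
  have hPall : ∀ j ≤ n, P j = 0 := by
    intro j
    induction j with
    | zero =>
        intro _
        rcases hP0 with h0 | h0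
        · subst h0; exact hPn
        · exact h0
    | succ j ih =>
        intro hj1
        have hj : j < n := by omega
        have hPj := ih hj.le
        obtain ⟨-, hkb, hrep⟩ := hdec j hj
        -- differentiate the representation twice on `(−∞, X')`
        set k : ℝ → ℝ := fun σ => V σ * F j σ + (F (j + 1) σ - (P (j + 1)).eval σ) with hk
        have hkc : Continuous k := by
          simp only [hk]
          exact ((hV.mul (hFc j hj.le)).add ((hFc (j + 1) (by omega)).sub
            (P (j + 1)).continuous))
        have hγ2 : 0 < γ / 2 := half_pos hγ
        have hT1 : ∀ x, HasDerivAt (fun y => ∫ s in Iic y, ∫ σ in Iic s, k σ)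
            (∫ σ in Iic x, k σ) x := hasDerivAt_leftTail2 hγ2 hkc hkb
        have hT0 : ∀ x, HasDerivAt (fun y => ∫ σ in Iic y, k σ) (k x) x :=
          hasDerivAt_leftTail hγ2 hkc hkb
        have hrep' : ∀ x < X', F j x = ∫ s in Iic x, ∫ σ in Iic s, k σ := fun x hx => by
          have := hrep x hx
          rw [hPj, eval_zero, zero_add] at this
          exact this
        -- first derivatives agree
        have hg_eq : ∀ x < X', g j x = ∫ σ in Iic x, k σ := by
          intro x hx
          have hev : F j =ᶠ[𝓝 x] fun y => ∫ s in Iic y, ∫ σ in Iic s, k σ := by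
            filter_upwards [Iio_mem_nhds hx] with y hy using hrep' y hy
          exact (hFd j hj x hx).unique ((hT1 x).congr_of_eventuallyEq hev)
        -- second derivatives agree
        have hk_eq : ∀ x < X', V x * F j x + F (j + 1) x = k x := by
          intro x hx
          have hev : g j =ᶠ[𝓝 x] fun y => ∫ σ in Iic y, k σ := by
            filter_upwards [Iio_mem_nhds hx] with y hy using hg_eq y hy
          exact (hGd j hj x hx).unique ((hT0 x).congr_of_eventuallyEq hev)
        refine polynomial_eq_zero_of_eval_eq_zero_Iio (X := X') fun x hx => ?_
        have := hk_eq x hx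
        simp only [hk] at this
        linarith
  -- Step 4: vanishing, downwards, for the ORIGINAL chain on `(−∞, xe)`
  suffices hdown : ∀ m ≤ n, ∀ x < xe, f (n - m) x = 0 by
    intro j hj x hx
    have := hdown (n - j) (by omega) x hx
    rwa [show n - (n - j) = j by omega] at this
  intro m
  induction m with
  | zero => intro _ x hx; simpa using htop x hx
  | succ m ih =>
      intro hm x hx
      set j : ℕ := n - (m + 1) with hjdef
      have hj : j < n := by omega
      have hj1 : j + 1 = n - m := by omega
      have hup : ∀ y < xe, f (j + 1) y = 0 := fun y hy => by rw [hj1]; exact ih (by omega) y hy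
      have hFup : ∀ y, F (j + 1) y = 0 := fun y => hup _ (hmin y)
      obtain ⟨hPb, -, hrep⟩ := hdec j hj
      -- homogeneous Volterra form of the clamped `F j`
      have hrep' : ∀ y < X', F j y = ∫ s in Iic y, ∫ σ in Iic s, V σ * F j σ := by
        intro y hy
        have := hrep y hy
        rw [hPall j hj.le, hPall (j + 1) (by omega)] at this
        simpa [hFup] using this
      have hFb : ∀ y ≤ X, |F j y| ≤ C * Real.exp (γ / 2 * y) := fun y hy => by
        simpa [hPall j hj.le] using hPb y hy
      have hzero : ∀ y ≤ X₃, F j y = 0 :=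
        eq_zero_of_volterra_leftTail2 hV hγ hVbX hXX' (hFc j hj.le) hFb hrep' hX₃ hX₃X
      -- hence `f j = 0` near `X₃ - 1`, and everywhere on `(−∞, xe)` by uniqueness
      have hX₃X' : X₃ ≤ X' := hX₃X.trans hXX'.le
      have hfzero : ∀ y ≤ X₃, f j y = 0 := fun y hy => by
        rw [← hFeq j y (hy.trans hX₃X')]; exact hzero y hy
      set t₀ : ℝ := X₃ - 1 with ht₀
      have ht₀X₃ : t₀ < X₃ := by simp only [ht₀]; linarith
      have hf0 : f j t₀ = 0 := hfzero t₀ ht₀X₃.le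
      have hg0 : g j t₀ = 0 := by
        have hev : f j =ᶠ[𝓝 t₀] fun _ => (0 : ℝ) := by
          filter_upwards [Iio_mem_nhds ht₀X₃] with y hy using hfzero y hy.le
        have h1 : HasDerivAt (f j) 0 t₀ := (hasDerivAt_const t₀ (0 : ℝ)).congr_of_eventuallyEq hev
        exact (hf j hj t₀ (by linarith [hX₃X, hXX', hX'e])).unique h1
      -- uniqueness for `u'' = V u` on `(a, xe)` with `a < min x t₀`
      set a : ℝ := min x t₀ - 1 with ha
      have hat₀ : t₀ ∈ Ioo a xe := ⟨by simp only [ha]; linarith [min_le_right x t₀],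
        by linarith [hX₃X, hXX', hX'e]⟩
      have hxa : x ∈ Ioo a xe := ⟨by simp only [ha]; linarith [min_le_left x t₀], hx⟩
      have huniq := eqOn_of_solution_Ioo (𝕜 := ℝ) (p := fun _ => (0 : ℝ)) (q := V)
        (a := a) (b := xe) (t₀ := t₀) continuousOn_const hV.continuousOn hat₀
        (u := f j) (u' := g j) (v := fun _ => 0) (v' := fun _ => 0)
        (fun t ht => ⟨hf j hj t ht.2, by
          have := hg j hj t ht.2
          rw [hup t ht.2] at this
          exact this.congr_deriv (by ring)⟩)
        (fun t _ => ⟨hasDerivAt_const t 0, by simpa using hasDerivAt_const t (0 : ℝ)⟩)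
        hf0 hg0
      exact huniq.1 hxa

end

end Literature.Analysis.ODE
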